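import Summits.Ventures.Crystal3D.Theorems.StickyWulffConstantGenericWallFloorLineCountOffset
import Summits.Ventures.Crystal3D.Theorems.StickyWulffConstantCoaxialWallLawRunEnds
import Mathlib.LinearAlgebra.Matrix.Nondegenerate
import HarnessLib

/-!
# Forced run ends through a clamped cell: the geometric count (riser ledger)

HONEST FRAMING. Part of the venture `Summits/Ventures/Crystal3D` (cell `crystal3d-full`), helper
`--supports` the crux `CoaxialWallLaw` (stmt-Ventures-19481, `route-Ventures-StickyWulffConstant`),
REGISTERED line `WallLedgerF` (planner cf-p1 gen 16), stub `stub_coaxialTwoSlabAdhesion`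
(terrace/riser slot ledger); usable by `WallLedgerG` (stmt-Ventures-19480).  Combines the
lattice-free per-class line count with offset and window (`lineCount_offset_window`, seat
19480-p1) with the run-end extraction `card_le_card_vacant_of_blocked` (`…CoaxialWallLawRunEnds`).

SETTING (the pulled-back cell of one grain).  A unimodular frame `(Ea, Eb, W)` of the lattice
(`‖Ea‖, ‖Eb‖ ≤ 1`, `‖W‖ = 1`, `det² = 1/2`), a unit normal `ν` (the cell axis seen from the grain),
an offset `s`, a bond class `W` climbing the cell (`α = ⟪W, ν⟫ > 0`).  `S` is the set of occupied
sites of the grain (all of the form `a•Ea + b•Eb + t•W`); it is COMPLETE in the clamped window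
`{lo₁ ≤ ⟪p + s, ν⟫ ≤ lo₁ + R, lateral(p + s) ≤ r}` and EMPTY in the blocked window
`{lo₂ ≤ ⟪p + s, ν⟫ ≤ lo₂ + R', lateral(p + s) ≤ ρ_b}` (inside the other grain's clamped slab every
site of this grain is within `1/√2` of an occupied foreign site, hence vacant — that step is not in
this file), with `lo₁ + R < lo₂`, `R' ≥ 1` and the reach condition `r + (lo₂ − lo₁)/α + 1 ≤ ρ_b`
(a `W`-line leaving the clamped window inside radius `r` is still inside radius `ρ_b` when it enters
the blocked window: lateral drift at most `1` per step, at most `(lo₂ − lo₁)/α + 1` steps).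

**Theorem (`forced_runEnds_offset`).**  `√2 α π r² − 10 √2 π r ≤ #{x ∈ S : x + W ∉ S}`: every
`W`-line through the clamped sample carries an occupied site whose `W`-slot is VACANT, and there
are `√2 α π r² − O(r)` such lines.  With `…CoaxialWallLawTilt` (`Σ_in-plane classes √2|α| ≥ √6 sinθ`)
this is the riser count of the ledger; the absorption inequality (`…SingleVacancy`,
`…DoubleVacancy`, `…Ribbon`, and the remaining three-partner lemmas) converts vacant in-plane slots
into deficiency.
Also: `frame_coords_unique` (integer frame coordinates are unique), `lateral_norm_*` plumbing.
WHAT THIS IS NOT: the pull-back to the cell's `(A, t)` data and the vacancy of the blocked window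
(assembly work); the stub; rung F-C1 not moved.
-/

noncomputable section

namespace Summit.Ventures.Crystal3D.Theorems

open Summit.Ventures.Crystal3D Finset Matrix
open scoped InnerProductSpace

/-- Coordinates in a frame with non-zero determinant are unique (real coefficients). -/
theorem frame_coords_unique (Ea Eb W : EuclideanSpace ℝ (Fin 3))
    (hdet : Matrix.det ![WithLp.ofLp Ea, WithLp.ofLp Eb, WithLp.ofLp W] ≠ 0)
    (a b t a' b' t' : ℝ)
    (h : a • Ea + b • Eb + t • W = a' • Ea + b' • Eb + t' • W) :
    a = a' ∧ b = b' ∧ t = t' := by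
  set M : Matrix (Fin 3) (Fin 3) ℝ := ![WithLp.ofLp Ea, WithLp.ofLp Eb, WithLp.ofLp W] with hM
  have hzero : (a - a') • Ea + (b - b') • Eb + (t - t') • W = 0 := by
    rw [sub_smul, sub_smul, sub_smul]
    have : a • Ea + b • Eb + t • W - (a' • Ea + b' • Eb + t' • W) = 0 := sub_eq_zero.2 h
    calc a • Ea - a' • Ea + (b • Eb - b' • Eb) + (t • W - t' • W)
        = a • Ea + b • Eb + t • W - (a' • Ea + b' • Eb + t' • W) := by abel
      _ = 0 := this
  have hvec : Matrix.vecMul ![a - a', b - b', t - t'] M = 0 := by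
    funext j
    have hj : ((a - a') • Ea + (b - b') • Eb + (t - t') • W) j = 0 := by
      rw [hzero]; rfl
    simp only [Matrix.vecMul, dotProduct, Fin.sum_univ_three, hM, Matrix.cons_val_zero,
      Matrix.cons_val_one, Matrix.cons_val_two, Pi.zero_apply]
    simpa [mul_comm] using hj
  have h0 := Matrix.eq_zero_of_vecMul_eq_zero hdet hvec
  have e0 : a - a' = 0 := by simpa using congrFun h0 0
  have e1 : b - b' = 0 := by simpa using congrFun h0 1
  have e2 : t - t' = 0 := by simpa using congrFun h0 2
  exact ⟨by linarith, by linarith, by linarith⟩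

/-- The lateral projection off the unit normal `ν`. -/
theorem lateral_norm_sq (ν p : EuclideanSpace ℝ (Fin 3)) (hν : ‖ν‖ = 1) :
    ‖p - ⟪p, ν⟫_ℝ • ν‖ ^ 2 = ‖p‖ ^ 2 - ⟪p, ν⟫_ℝ ^ 2 :=
  norm_sub_inner_smul_sq ν p hν

/-- The lateral projection is additive. -/
theorem lateral_add (ν p q : EuclideanSpace ℝ (Fin 3)) :
    (p + q) - ⟪p + q, ν⟫_ℝ • ν = (p - ⟪p, ν⟫_ℝ • ν) + (q - ⟪q, ν⟫_ℝ • ν) := by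
  rw [inner_add_left, add_smul]; abel

/-- The lateral projection of an integer multiple. -/
theorem lateral_nsmul (ν q : EuclideanSpace ℝ (Fin 3)) (j : ℕ) :
    ((j : ℝ) • q) - ⟪(j : ℝ) • q, ν⟫_ℝ • ν = (j : ℝ) • (q - ⟪q, ν⟫_ℝ • ν) := by
  rw [inner_smul_left]; simp only [conj_trivial]; rw [smul_sub, smul_smul]

/-- The lateral norm of a vector is at most its norm. -/
theorem lateral_norm_le (ν q : EuclideanSpace ℝ (Fin 3)) (hν : ‖ν‖ = 1) :
    ‖q - ⟪q, ν⟫_ℝ • ν‖ ≤ ‖q‖ := by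
  have h := lateral_norm_sq ν q hν
  have h1 : ‖q - ⟪q, ν⟫_ℝ • ν‖ ^ 2 ≤ ‖q‖ ^ 2 := by rw [h]; nlinarith [sq_nonneg ⟪q, ν⟫_ℝ]
  exact (pow_le_pow_iff_left₀ (norm_nonneg _) (norm_nonneg _) two_ne_zero).1 h1

/-- **Forced run ends through the cell (one climbing bond class, pulled-back frame).**  See the
module docstring for the setting.  Conclusion: `√2 α π r² − 10 √2 π r ≤ #{x ∈ S : x + W ∉ S}`. -/
theorem forced_runEnds_offset (ν : EuclideanSpace ℝ (Fin 3)) (hν : ‖ν‖ = 1)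
    (Ea Eb W s : EuclideanSpace ℝ (Fin 3)) (hEa : ‖Ea‖ ≤ 1) (hEb : ‖Eb‖ ≤ 1) (hW : ‖W‖ = 1)
    (hdet : (Matrix.det ![WithLp.ofLp Ea, WithLp.ofLp Eb, WithLp.ofLp W]) ^ 2 = 1 / 2)
    (hα : 0 < ⟪W, ν⟫_ℝ) (R r lo₁ lo₂ R' ρb : ℝ) (hR : 1 ≤ R) (hr : R ≤ r) (hR' : 1 ≤ R')
    (hsep : lo₁ + R < lo₂) (hreach : r + (lo₂ - lo₁) / ⟪W, ν⟫_ℝ + 1 ≤ ρb)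
    (S : Finset (EuclideanSpace ℝ (Fin 3)))
    (hSlat : ∀ x ∈ S, ∃ a b t : ℤ, x = (a : ℝ) • Ea + (b : ℝ) • Eb + (t : ℝ) • W)
    (hcomplete : ∀ a b t : ℤ,
      lo₁ ≤ ⟪(a : ℝ) • Ea + (b : ℝ) • Eb + (t : ℝ) • W + s, ν⟫_ℝ →
      ⟪(a : ℝ) • Ea + (b : ℝ) • Eb + (t : ℝ) • W + s, ν⟫_ℝ ≤ lo₁ + R →
      ‖(a : ℝ) • Ea + (b : ℝ) • Eb + (t : ℝ) • W + s‖ ^ 2 -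
          ⟪(a : ℝ) • Ea + (b : ℝ) • Eb + (t : ℝ) • W + s, ν⟫_ℝ ^ 2 ≤ r ^ 2 →
      (a : ℝ) • Ea + (b : ℝ) • Eb + (t : ℝ) • W ∈ S)
    (hblocked : ∀ a b t : ℤ,
      lo₂ ≤ ⟪(a : ℝ) • Ea + (b : ℝ) • Eb + (t : ℝ) • W + s, ν⟫_ℝ →
      ⟪(a : ℝ) • Ea + (b : ℝ) • Eb + (t : ℝ) • W + s, ν⟫_ℝ ≤ lo₂ + R' →
      ‖(a : ℝ) • Ea + (b : ℝ) • Eb + (t : ℝ) • W + s‖ ^ 2 -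
          ⟪(a : ℝ) • Ea + (b : ℝ) • Eb + (t : ℝ) • W + s, ν⟫_ℝ ^ 2 ≤ ρb ^ 2 →
      (a : ℝ) • Ea + (b : ℝ) • Eb + (t : ℝ) • W ∉ S) :
    Real.sqrt 2 * ⟪W, ν⟫_ℝ * Real.pi * r ^ 2 - 10 * Real.sqrt 2 * Real.pi * r ≤
      ((S.filter fun x => x + W ∉ S).card : ℝ) := by
  classical
  set α : ℝ := ⟪W, ν⟫_ℝ with hαdef
  have hdet0 : Matrix.det ![WithLp.ofLp Ea, WithLp.ofLp Eb, WithLp.ofLp W] ≠ 0 := by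
    intro h; rw [h] at hdet; norm_num at hdet
  -- frame coordinates `π x = (a, b)`
  have huniq : ∀ a b t a' b' t' : ℤ,
      (a : ℝ) • Ea + (b : ℝ) • Eb + (t : ℝ) • W = (a' : ℝ) • Ea + (b' : ℝ) • Eb + (t' : ℝ) • W →
      a = a' ∧ b = b' ∧ t = t' := by
    intro a b t a' b' t' h
    obtain ⟨h1, h2, h3⟩ := frame_coords_unique Ea Eb W hdet0 _ _ _ _ _ _ h
    exact ⟨by exact_mod_cast h1, by exact_mod_cast h2, by exact_mod_cast h3⟩
  let π : EuclideanSpace ℝ (Fin 3) → ℤ × ℤ := fun x =>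
    if h : ∃ c : ℤ × ℤ × ℤ, x = (c.1 : ℝ) • Ea + (c.2.1 : ℝ) • Eb + (c.2.2 : ℝ) • W then
      ((Classical.choose h).1, (Classical.choose h).2.1) else (0, 0)
  have hπ : ∀ a b t : ℤ, π ((a : ℝ) • Ea + (b : ℝ) • Eb + (t : ℝ) • W) = (a, b) := by
    intro a b t
    have hex : ∃ c : ℤ × ℤ × ℤ, (a : ℝ) • Ea + (b : ℝ) • Eb + (t : ℝ) • W =
        (c.1 : ℝ) • Ea + (c.2.1 : ℝ) • Eb + (c.2.2 : ℝ) • W := ⟨(a, b, t), rfl⟩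
    simp only [π, dif_pos hex]
    have hc := Classical.choose_spec hex
    obtain ⟨h1, h2, -⟩ := huniq _ _ _ _ _ _ hc
    rw [← h1, ← h2]
  -- the clamped sample and its line set
  set S' := S.filter fun x => lo₁ ≤ ⟪x + s, ν⟫_ℝ ∧ ⟪x + s, ν⟫_ℝ ≤ lo₁ + R ∧
    ‖x + s‖ ^ 2 - ⟪x + s, ν⟫_ℝ ^ 2 ≤ r ^ 2 with hS'
  set T : Finset (ℤ × ℤ) := S'.image π with hT
  have hcount := lineCount_offset_window ν hν R r lo₁ hR hr Ea Eb W s hEa hEb hW hdet T (by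
    intro a b t h1 h2 h3
    rw [hT, mem_image]
    refine ⟨_, ?_, hπ a b t⟩
    rw [hS', mem_filter]
    exact ⟨hcomplete a b t h1 h2 h3, h1, h2, h3⟩)
  -- a section of `π` over `T`: the anchors
  have hsec : ∀ τ ∈ T, ∃ x ∈ S', π x = τ := fun τ hτ => by
    simpa [hT, mem_image] using hτ
  choose! σ hσS' hσπ using hsec
  set A : Finset (EuclideanSpace ℝ (Fin 3)) := T.image σ with hA
  have hσinj : Set.InjOn σ T := by
    intro τ hτ τ' hτ' h
    rw [← hσπ τ hτ, ← hσπ τ' hτ', h]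
  have hAcard : A.card = T.card := card_image_of_injOn hσinj
  have hS'S : S' ⊆ S := filter_subset _ _
  have hAS : A ⊆ S := by
    intro x hx
    obtain ⟨τ, hτ, rfl⟩ := mem_image.1 hx
    exact hS'S (hσS' τ hτ)
  -- anchors lie on distinct `W`-lines
  have hlines : ∀ a ∈ A, ∀ a' ∈ A, a ≠ a' → ∀ k : ℤ, a' ≠ a + (k : ℝ) • W := by
    intro x hx x' hx' hne k hk
    obtain ⟨τ, hτ, rfl⟩ := mem_image.1 hx
    obtain ⟨τ', hτ', rfl⟩ := mem_image.1 hx'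
    apply hne
    obtain ⟨a, b, t, he⟩ := hSlat _ (hS'S (hσS' τ hτ))
    have hπ1 : π (σ τ) = (a, b) := by rw [he]; exact hπ a b t
    have hπ2 : π (σ τ') = (a, b) := by
      rw [hk, he]
      have e : (a : ℝ) • Ea + (b : ℝ) • Eb + (t : ℝ) • W + (k : ℝ) • W =
          (a : ℝ) • Ea + (b : ℝ) • Eb + ((t + k : ℤ) : ℝ) • W := by
        push_cast; rw [add_smul]; abel
      rw [e]; exact hπ a b (t + k)
    have hττ' : τ = τ' := by rw [← hσπ τ hτ, ← hσπ τ' hτ', hπ1, hπ2]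
    rw [hττ']
  -- every anchor's line enters the blocked window inside the blocked radius
  have hblock : ∀ x ∈ A, ∃ k : ℕ, x + ((k : ℝ) + 1) • W ∉ S := by
    intro x hx
    obtain ⟨τ, hτ, rfl⟩ := mem_image.1 hx
    have hxS' := hσS' τ hτ
    rw [hS', mem_filter] at hxS'
    obtain ⟨hxS, hlo, hhi, hlat⟩ := hxS'
    obtain ⟨a, b, t, he⟩ := hSlat _ hxS
    set ht : ℝ := ⟪σ τ + s, ν⟫_ℝ with hhtdef
    -- number of steps
    have hgap : 0 < lo₂ - ht := by linarith
    set j : ℕ := ⌈(lo₂ - ht) / α⌉₊ with hjdef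
    have hjge : (lo₂ - ht) / α ≤ (j : ℝ) := Nat.le_ceil _
    have hjlt : (j : ℝ) < (lo₂ - ht) / α + 1 := Nat.ceil_lt_add_one (by positivity)
    have hjpos : 0 < j := Nat.ceil_pos.2 (by positivity)
    obtain ⟨k, hk⟩ : ∃ k : ℕ, j = k + 1 := ⟨j - 1, by omega⟩
    refine ⟨k, ?_⟩
    have hkj : ((k : ℝ) + 1) = (j : ℝ) := by rw [hk]; push_cast; ring
    rw [hkj]
    -- the point `x + j W` in frame coordinates
    have he' : σ τ + (j : ℝ) • W = (a : ℝ) • Ea + (b : ℝ) • Eb + ((t + j : ℤ) : ℝ) • W := by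
      rw [he]; push_cast; rw [add_smul]; abel
    rw [he']
    -- height of the shifted point
    have hheight : ⟪(a : ℝ) • Ea + (b : ℝ) • Eb + ((t + j : ℤ) : ℝ) • W + s, ν⟫_ℝ = ht + (j : ℝ) * α := by
      rw [← he', hhtdef, hαdef]
      have : σ τ + (j : ℝ) • W + s = (σ τ + s) + (j : ℝ) • W := by abel
      rw [this, inner_add_left, inner_smul_left]; simp
    have hjα1 : lo₂ - ht ≤ (j : ℝ) * α := by
      have := mul_le_mul_of_nonneg_right hjge hα.le
      rwa [div_mul_cancel₀ _ (ne_of_gt hα)] at this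
    have hjα2 : (j : ℝ) * α < lo₂ - ht + α := by
      have := mul_lt_mul_of_pos_right hjlt hα
      rwa [add_mul, one_mul, div_mul_cancel₀ _ (ne_of_gt hα)] at this
    have hα1 : α ≤ 1 := by
      have h := abs_real_inner_le_norm W ν
      rw [hW, hν, one_mul] at h
      exact (le_abs_self _).trans h
    apply hblocked a b (t + j)
    · rw [hheight]; linarith
    · rw [hheight]; linarith
    · -- lateral bound: `lat(x + s + jW) ≤ lat(x + s) + j ≤ r + j ≤ ρb`
      rw [← he']
      have hsplit : σ τ + (j : ℝ) • W + s = (σ τ + s) + (j : ℝ) • W := by abel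
      rw [hsplit, ← lateral_norm_sq ν _ hν, lateral_add, lateral_nsmul]
      have hlatx : ‖σ τ + s - ⟪σ τ + s, ν⟫_ℝ • ν‖ ≤ r := by
        have h1 : ‖σ τ + s - ⟪σ τ + s, ν⟫_ℝ • ν‖ ^ 2 ≤ r ^ 2 := by
          rw [lateral_norm_sq ν _ hν]; exact hlat
        exact (pow_le_pow_iff_left₀ (norm_nonneg _) (by linarith) two_ne_zero).1 h1
      have hlatW : ‖(j : ℝ) • (W - ⟪W, ν⟫_ℝ • ν)‖ ≤ (j : ℝ) := by
        rw [norm_smul, Real.norm_eq_abs, abs_of_nonneg (by positivity : (0 : ℝ) ≤ j)]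
        have := lateral_norm_le ν W hν
        rw [hW] at this
        nlinarith
      have hjbound : (j : ℝ) ≤ (lo₂ - lo₁) / α + 1 := by
        have h1 : (lo₂ - ht) / α ≤ (lo₂ - lo₁) / α :=
          div_le_div_of_nonneg_right (by linarith) hα.le
        linarith
      have htri := norm_add_le (σ τ + s - ⟪σ τ + s, ν⟫_ℝ • ν) ((j : ℝ) • (W - ⟪W, ν⟫_ℝ • ν))
      have hρb : ‖σ τ + s - ⟪σ τ + s, ν⟫_ℝ • ν + (j : ℝ) • (W - ⟪W, ν⟫_ℝ • ν)‖ ≤ ρb := by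
        linarith
      have h0 : 0 ≤ ‖σ τ + s - ⟪σ τ + s, ν⟫_ℝ • ν + (j : ℝ) • (W - ⟪W, ν⟫_ℝ • ν)‖ := norm_nonneg _
      exact pow_le_pow_left₀ h0 hρb 2
  have hmain := card_le_card_vacant_of_blocked S A W hAS hlines hblock
  calc Real.sqrt 2 * α * Real.pi * r ^ 2 - 10 * Real.sqrt 2 * Real.pi * r
      ≤ (T.card : ℝ) := by
        have h := hcount
        rwa [abs_of_pos hα] at h
    _ = (A.card : ℝ) := by rw [hAcard]
    _ ≤ ((S.filter fun x => x + W ∉ S).card : ℝ) := by exact_mod_cast hmain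

end Summit.Ventures.Crystal3D.Theorems

end
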